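import Summits.BirchSwinnertonDyer.BirchSwinnertonDyer.Theses.ThetaPartnerAtTwo
import HarnessLib

/-!
# Route `ThetaPartnerAtTwo` (TP2) rev 36: the μ-SPLIT of the CM crux is LOSSLESS — K2r0P `SignedMainConjectureCMTwoRankZeroOfPub`
# (stmt-BirchSwinnertonDyer-24945, now the derived support node) ⟺ FLAT `AnalyticMuFlatCMTwoRankZero` (stmt-…-26470) ∧ K2R0P♭
# `SignedMainConjectureCMTwoRankZeroOfPubOfFlat` (stmt-…-26471), BY NAME on the route's decls

HONEST FRAMING (cell `pub/bsd-wall`, lead prover `bsd-wall-tp2-p2` g8, 2026-08-28). Pure glue (`fun`-terms), the tree-side copy of the pen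
certificate `Cruxes/SignedMainConjectureCMTwoRankZeroOfPub/K2r0PFlatCert.lean` v2 (iv)–(vi) written against the LIVE route decls of rev 36
(pen bsd-wall-p2 g16, director W-78 (c)): nothing is proved about any curve; all three statements stay open; BSD is not proved by any of this.
* `signedMainConjectureCMTwoRankZeroOfPub_of_flat_of_ofPubOfFlat` : FLAT → K2R0P♭ → K2r0P (how 24945 closes once 26470 and 26471 do);
* `signedMainConjectureCMTwoRankZeroOfPubOfFlat_of_ofPub` : K2r0P → K2R0P♭ (the twin is weaker: drop the FLAT hypothesis).
References: [PollackRubin2004] Thm. 7.3 (p > 2); [Kato2004Asterisque] Prop. 15.9; [BurungaleFlach2024] Thm. 1.1.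
-/

set_option autoImplicit false
-- the Theorems namespace of this sub repeats the summit name by design (D-0017 nested layout)
set_option linter.dupNamespace false

namespace Summit.BirchSwinnertonDyer.BirchSwinnertonDyer.Theorems

open Summit.BirchSwinnertonDyer.BirchSwinnertonDyer.Theses.ThetaPartnerAtTwo

/-- **K2r0P from FLAT and K2R0P♭** (rev 36 decls by name): the derived node stmt-BirchSwinnertonDyer-24945 closes the moment its two
factors do. [cite: PollackRubin2004, Thm. 7.3 (p > 2)] [cite: BurungaleFlach2024, Thm. 1.1] -/
theorem signedMainConjectureCMTwoRankZeroOfPub_of_flat_of_ofPubOfFlat (hμ : AnalyticMuFlatCMTwoRankZero)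
    (h : SignedMainConjectureCMTwoRankZeroOfPubOfFlat) : SignedMainConjectureCMTwoRankZeroOfPub :=
  fun hBF hmod hLrat hGZK h2 hC h412 hcork hP108 hWL A _ _ hcm hr hss ha ↦
    h hBF hmod hLrat hGZK h2 hC h412 hcork hP108 hWL hμ A hcm hr hss ha

/-- **K2R0P♭ from K2r0P** (drop the FLAT hypothesis). [cite: PollackRubin2004, Thm. 7.3 (p > 2)] -/
theorem signedMainConjectureCMTwoRankZeroOfPubOfFlat_of_ofPub (h : SignedMainConjectureCMTwoRankZeroOfPub) :
    SignedMainConjectureCMTwoRankZeroOfPubOfFlat :=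
  fun hBF hmod hLrat hGZK h2 hC h412 hcork hP108 hWL _ A _ _ hcm hr hss ha ↦
    h hBF hmod hLrat hGZK h2 hC h412 hcork hP108 hWL A hcm hr hss ha

end Summit.BirchSwinnertonDyer.BirchSwinnertonDyer.Theorems
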